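import Summits.AtomisticToContinuum.Crystallization.Theorems.ThreeConeCertificateExactCertificateSlacknessEnergy

/-!
# `ExactCertificate` (stmt-AtomisticToContinuum-11959): lattice periodisation of a positive-type
# radial kernel, I — block averages and positive type of the periodisation

Let `P` be a periodic configuration of `ℝ³`, `latVec P d` (`d ∈ ℤ³`) its periods in a `ℤ`-basis,
and `f` a radial kernel whose coset families `d ↦ f(|v − latVec P d|)` are summable.  The
*periodisation* of `f` is `v ↦ Σ_d f(|v − latVec P d|)`.

* `blockAverage`: the double sums over the lattice block `[0,K)³`,
  `Σ_{k,k'} f(|v − latVec P (k' − k)|)`, equal `K³ · Σ_d f(|v − latVec P d|) + o(K³)`.  Indeed the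
  row of a `D`-deep index `k` is the sum of the family over a finite set containing the box
  `(−D,D)³`, so it misses at most the (small) tail of the family outside a large finite set,
  every row misses at most `Σ_d |f(|v − latVec P d|)|`, and only `≤ 6DK²` indices are not deep
  (`card_not_deep_le`); the statement is first proved for an abstract summable family on `ℤ³`
  (`blockAverage_of_summable`).
* `periodisation_posType`: if `f` is of positive type on `ℝ³` (all finite Gram sums
  `Σ wᵢwⱼ f(|yᵢ − yⱼ|)` are `≥ 0`, transported to arbitrary finite index types in
  `posType_fintype`), then so is its periodisation: the Gram sum of `f` at the block translates
  `uᵢ + latVec P k`, `k ∈ [0,K)³`, with weights `wᵢ`, is `≥ 0` and equals the weighted block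
  double sum (`gram_block_nonneg`), which is `K³ ·` (Gram sum of the periodisation) `+ o(K³)`.

Part 0 (`…FieldSummable`) shows that the summability hypothesis holds for every eventually
non-positive positive-type `f`, in particular for the `f` of every split.  All `[folklore]`.
-/

noncomputable section

namespace Summit.AtomisticToContinuum.Crystallization.Theorems.ThreeConeCertificateExactCertificate.Field

open Literature.MathematicalPhysics.StatisticalMechanics
open Summit.AtomisticToContinuum.Crystallization.Theorems.ChargedEnergyGapNegative (E3)
open Summit.AtomisticToContinuum.Crystallization.Theorems.ChargedEnergyGapNegative.Blocks
  (latVec latVec_mem latVec_add latVec_sub latVec_neg latVec_zero latVec_injective exists_latVec_eq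
    coords coords_injective IsDeep card_not_deep_le)
open Filter Topology
open scoped BigOperators

/-! ## Positive type on arbitrary finite index types -/

/-- Positive type transported from `Fin n` to an arbitrary finite index type (as in part 0,
restated here to keep this file independent of it). [folklore] -/
theorem posType_fintype (f : ℝ → ℝ)
    (hpd : ∀ (n : ℕ) (y : Fin n → E3) (w : Fin n → ℝ),
      0 ≤ ∑ i, ∑ j, w i * w j * f (dist (y i) (y j)))
    (ι : Type*) [Fintype ι] (y : ι → E3) (w : ι → ℝ) :
    0 ≤ ∑ i, ∑ j, w i * w j * f (dist (y i) (y j)) := by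
  set e : Fin (Fintype.card ι) ≃ ι := (Fintype.equivFin ι).symm
  have h : 0 ≤ ∑ a : Fin (Fintype.card ι), ∑ b : Fin (Fintype.card ι),
      w (e a) * w (e b) * f (dist (y (e a)) (y (e b))) :=
    hpd (Fintype.card ι) (fun a => y (e a)) (fun a => w (e a))
  have heq : ∑ a : Fin (Fintype.card ι), ∑ b : Fin (Fintype.card ι),
      w (e a) * w (e b) * f (dist (y (e a)) (y (e b))) =
      ∑ i, ∑ j, w i * w j * f (dist (y i) (y j)) :=
    (e.sum_comp (fun i => ∑ b : Fin (Fintype.card ι),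
      w i * w (e b) * f (dist (y i) (y (e b))))).trans
      (Finset.sum_congr rfl fun i _ => e.sum_comp (fun j => w i * w j * f (dist (y i) (y j))))
  exact h.trans_eq heq

/-! ## Block averages of a summable family on `ℤ³` -/

/-- Tail estimate: a summable real family minus its sum over a finite set is at most, in absolute
value, the sum of the absolute values outside the set. [folklore] -/
theorem abs_tsum_sub_sum_le {β : Type*} {ψ : β → ℝ} (hψ : Summable ψ) (s : Finset β) :
    |∑' d, ψ d - ∑ d ∈ s, ψ d| ≤ ∑' d : {d // d ∉ s}, |ψ d.1| := by
  have h1 : ∑' d, ψ d - ∑ d ∈ s, ψ d = ∑' d : {d // d ∉ s}, ψ d.1 := by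
    rw [← hψ.sum_add_tsum_subtype_compl s, add_sub_cancel_left]
  have h2 : Summable fun d : {d // d ∉ s} => ‖ψ d.1‖ := hψ.abs.subtype (fun d => d ∉ s)
  rw [h1]
  exact norm_tsum_le_tsum_norm h2

/-- A row of the block double sum is the sum of the family over the (injective) image of the
difference map `k' ↦ coords k' − coords k`. [folklore] -/
theorem row_eq_sum_image (K : ℕ) (ψ : (Fin 3 → ℤ) → ℝ) (k : Fin 3 → Fin K) :
    ∑ k' : Fin 3 → Fin K, ψ (coords K k' - coords K k) =
      ∑ d ∈ Finset.univ.image (fun k' : Fin 3 → Fin K => coords K k' - coords K k), ψ d := by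
  rw [Finset.sum_image]
  intro a _ b _ h
  exact coords_injective K (sub_left_injective h)

/-- The row of a `D`-deep index contains every lattice vector of the open box `(−D, D)³`.
[folklore] -/
theorem mem_image_of_isDeep {K D : ℕ} {k : Fin 3 → Fin K} (hk : IsDeep K D k) {d : Fin 3 → ℤ}
    (hd : ∀ i, (d i).natAbs < D) :
    d ∈ Finset.univ.image (fun k' : Fin 3 → Fin K => coords K k' - coords K k) := by
  rw [Finset.mem_image]
  refine ⟨fun i => ⟨(((k i : ℕ) : ℤ) + d i).toNat, ?_⟩, Finset.mem_univ _, ?_⟩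
  · have h1 := (hk i).1
    have h2 := (hk i).2
    have h3 := hd i
    omega
  · funext i
    have h1 := (hk i).1
    have h3 := hd i
    simp only [Pi.sub_apply, coords]
    omega

/-- **Block averages of a summable family on `ℤ³`**: for `ψ` summable and `ε > 0`,
`|Σ_{k,k' ∈ [0,K)³} ψ(k' − k) − K³ Σ ψ| ≤ ε K³` for all large `K`. [folklore] -/
theorem blockAverage_of_summable (ψ : (Fin 3 → ℤ) → ℝ) (hs : Summable ψ) {ε : ℝ} (hε : 0 < ε) :
    ∃ K₀ : ℕ, ∀ K : ℕ, K₀ ≤ K →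
      |∑ k : Fin 3 → Fin K, ∑ k' : Fin 3 → Fin K, ψ (coords K k' - coords K k)
          - (K : ℝ) ^ 3 * ∑' d : Fin 3 → ℤ, ψ d| ≤ ε * (K : ℝ) ^ 3 := by
  set S : ℝ := ∑' d, ψ d
  set C : ℝ := ∑' d, |ψ d|
  have hCnn : 0 ≤ C := tsum_nonneg fun _ => abs_nonneg _
  -- the tails of `|ψ|` are small outside a finite set `A₀`
  obtain ⟨A₀, hA₀⟩ : ∃ A₀ : Finset (Fin 3 → ℤ), ∑' d : {d // d ∉ A₀}, |ψ d.1| ≤ ε / 2 := by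
    have ht := tendsto_tsum_compl_atTop_zero (fun d : Fin 3 → ℤ => |ψ d|)
    obtain ⟨A₀, hA⟩ := eventually_atTop.1 (ht.eventually (gt_mem_nhds (half_pos hε)))
    exact ⟨A₀, (hA A₀ le_rfl).le⟩
  -- `A₀` lies in the box `(−D, D)³`
  obtain ⟨D, hD⟩ : ∃ D : ℕ, ∀ d ∈ A₀, ∀ i, (d i).natAbs < D := by
    refine ⟨A₀.sup (fun d => Finset.univ.sup fun i => (d i).natAbs) + 1, fun d hd i => ?_⟩
    have h1 : (d i).natAbs ≤ Finset.univ.sup (fun j => (d j).natAbs) :=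
      Finset.le_sup (f := fun j => (d j).natAbs) (Finset.mem_univ i)
    have h2 : Finset.univ.sup (fun j => (d j).natAbs) ≤
        A₀.sup (fun d' => Finset.univ.sup fun j => (d' j).natAbs) :=
      Finset.le_sup (f := fun d' : Fin 3 → ℤ => Finset.univ.sup fun j => (d' j).natAbs) hd
    omega
  -- row estimates: `ε/2` for deep rows, `ε/2 + C` for the others
  have hrow : ∀ (K : ℕ) (k : Fin 3 → Fin K),
      |∑ k' : Fin 3 → Fin K, ψ (coords K k' - coords K k) - S| ≤
        ε / 2 + if IsDeep K D k then 0 else C := by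
    intro K k
    set Dk := Finset.univ.image (fun k' : Fin 3 → Fin K => coords K k' - coords K k)
    have h1 : ∑ k' : Fin 3 → Fin K, ψ (coords K k' - coords K k) = ∑ d ∈ Dk, ψ d :=
      row_eq_sum_image K ψ k
    have h2 : |S - ∑ d ∈ Dk, ψ d| ≤ ∑' d : {d // d ∉ Dk}, |ψ d.1| := abs_tsum_sub_sum_le hs Dk
    rw [abs_sub_comm, h1]
    by_cases hk : IsDeep K D k
    · rw [if_pos hk, add_zero]
      have h3 : ∑' d : {d // d ∉ Dk}, |ψ d.1| ≤ ∑' d : {d // d ∉ A₀}, |ψ d.1| :=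
        ChargedEnergyGapNegative.Blocks.tsum_subtype_mono (f := fun d => |ψ d|) hs.abs
          (fun _ => abs_nonneg _) (fun d hd hdA => hd (mem_image_of_isDeep hk (hD d hdA)))
      exact h2.trans (h3.trans hA₀)
    · rw [if_neg hk]
      have h3 : ∑' d : {d // d ∉ Dk}, |ψ d.1| ≤ C :=
        hs.abs.tsum_subtype_le (fun d => |ψ d|) {d | d ∉ Dk} (fun _ => abs_nonneg _)
      linarith [h2.trans h3]
  -- choice of `K₀`: `12 D C / ε < K₀`
  obtain ⟨K₀, hK₀⟩ := exists_nat_gt (12 * (D : ℝ) * C / ε)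
  refine ⟨K₀, fun K hK => ?_⟩
  have hcard : (Fintype.card (Fin 3 → Fin K) : ℝ) = (K : ℝ) ^ 3 := by
    rw [Fintype.card_fun, Fintype.card_fin, Fintype.card_fin, Nat.cast_pow]
  have hnd : ((Finset.univ.filter fun k : Fin 3 → Fin K => ¬ IsDeep K D k).card : ℝ) ≤
      6 * D * (K : ℝ) ^ 2 := by exact_mod_cast card_not_deep_le K D
  have hsum : |∑ k : Fin 3 → Fin K, ∑ k' : Fin 3 → Fin K, ψ (coords K k' - coords K k) -
      (K : ℝ) ^ 3 * S| ≤ (K : ℝ) ^ 3 * (ε / 2) + 6 * D * (K : ℝ) ^ 2 * C := by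
    calc |∑ k : Fin 3 → Fin K, ∑ k' : Fin 3 → Fin K, ψ (coords K k' - coords K k) -
          (K : ℝ) ^ 3 * S|
        = |∑ k : Fin 3 → Fin K, (∑ k' : Fin 3 → Fin K, ψ (coords K k' - coords K k) - S)| := by
          rw [Finset.sum_sub_distrib, Finset.sum_const, Finset.card_univ, nsmul_eq_mul, hcard]
      _ ≤ ∑ k : Fin 3 → Fin K, |∑ k' : Fin 3 → Fin K, ψ (coords K k' - coords K k) - S| :=
          Finset.abs_sum_le_sum_abs _ _
      _ ≤ ∑ k : Fin 3 → Fin K, (ε / 2 + if IsDeep K D k then 0 else C) :=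
          Finset.sum_le_sum fun k _ => hrow K k
      _ = (K : ℝ) ^ 3 * (ε / 2) +
            ((Finset.univ.filter fun k : Fin 3 → Fin K => ¬ IsDeep K D k).card : ℝ) * C := by
          rw [Finset.sum_add_distrib, Finset.sum_const, Finset.card_univ, nsmul_eq_mul, hcard,
            Finset.sum_ite, Finset.sum_const_zero, zero_add, Finset.sum_const, nsmul_eq_mul]
      _ ≤ (K : ℝ) ^ 3 * (ε / 2) + 6 * D * (K : ℝ) ^ 2 * C :=
          add_le_add le_rfl (mul_le_mul_of_nonneg_right hnd hCnn)
  -- conclusion: `6 D K² C ≤ (ε/2) K³` for `K ≥ K₀`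
  have hKr : 12 * (D : ℝ) * C / ε < K := hK₀.trans_le (by exact_mod_cast hK)
  have h6 : 6 * (D : ℝ) * C ≤ ε / 2 * K := by
    rw [div_lt_iff₀ hε] at hKr
    linarith
  have hK2 : (0 : ℝ) ≤ (K : ℝ) ^ 2 := by positivity
  calc _ ≤ (K : ℝ) ^ 3 * (ε / 2) + 6 * D * (K : ℝ) ^ 2 * C := hsum
    _ = (K : ℝ) ^ 3 * (ε / 2) + 6 * (D : ℝ) * C * (K : ℝ) ^ 2 := by ring
    _ ≤ (K : ℝ) ^ 3 * (ε / 2) + ε / 2 * K * (K : ℝ) ^ 2 :=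
        add_le_add le_rfl (mul_le_mul_of_nonneg_right h6 hK2)
    _ = ε * (K : ℝ) ^ 3 := by ring

/-- **Block averages of a summable coset family** (`blockAverage_of_summable` for the family
`d ↦ f(|v − latVec P d|)`):
`Σ_{k,k' ∈ [0,K)³} f(|v − latVec P (k' − k)|) = K³ Σ_d f(|v − latVec P d|) + o(K³)`. [folklore] -/
theorem blockAverage (P : PeriodicConfiguration 3) (f : ℝ → ℝ) (v : E3)
    (hs : Summable fun d : Fin 3 → ℤ => f (dist v (latVec P d))) {ε : ℝ} (hε : 0 < ε) :
    ∃ K₀ : ℕ, ∀ K : ℕ, K₀ ≤ K →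
      |∑ k : Fin 3 → Fin K, ∑ k' : Fin 3 → Fin K, f (dist v (latVec P (coords K k' - coords K k)))
          - (K : ℝ) ^ 3 * ∑' d : Fin 3 → ℤ, f (dist v (latVec P d))| ≤ ε * (K : ℝ) ^ 3 :=
  blockAverage_of_summable (fun d => f (dist v (latVec P d))) hs hε

/-! ## Positive type of the periodisation -/

/-- Distances between lattice translates: `|x + L c − (y + L c')| = |(x − y) − L(c' − c)|`.
[folklore] -/
theorem dist_add_latVec_add (P : PeriodicConfiguration 3) (x y : E3) (c c' : Fin 3 → ℤ) :
    dist (x + latVec P c) (y + latVec P c') = dist (x - y) (latVec P (c' - c)) := by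
  rw [latVec_sub, dist_eq_norm, dist_eq_norm]
  congr 1
  abel

/-- The Gram sum of `f` at the block translates `uᵢ + latVec P k`, `k ∈ [0,K)³` (weights `wᵢ`),
is the weighted block double sum; hence the latter is `≥ 0` for `f` of positive type.
[folklore] -/
theorem gram_block_nonneg (P : PeriodicConfiguration 3) (f : ℝ → ℝ)
    (hpd : ∀ (n : ℕ) (y : Fin n → E3) (w : Fin n → ℝ),
      0 ≤ ∑ i, ∑ j, w i * w j * f (dist (y i) (y j)))
    (n : ℕ) (u : Fin n → E3) (w : Fin n → ℝ) (K : ℕ) :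
    0 ≤ ∑ i, ∑ j, w i * w j * ∑ k : Fin 3 → Fin K, ∑ k' : Fin 3 → Fin K,
      f (dist (u i - u j) (latVec P (coords K k' - coords K k))) := by
  have h : 0 ≤ ∑ p : Fin n × (Fin 3 → Fin K), ∑ q : Fin n × (Fin 3 → Fin K),
      w p.1 * w q.1 *
        f (dist (u p.1 + latVec P (coords K p.2)) (u q.1 + latVec P (coords K q.2))) :=
    posType_fintype f hpd (Fin n × (Fin 3 → Fin K)) (fun p => u p.1 + latVec P (coords K p.2))
      (fun p => w p.1)
  have heq : ∑ p : Fin n × (Fin 3 → Fin K), ∑ q : Fin n × (Fin 3 → Fin K),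
      w p.1 * w q.1 *
        f (dist (u p.1 + latVec P (coords K p.2)) (u q.1 + latVec P (coords K q.2))) =
      ∑ i, ∑ j, w i * w j * ∑ k : Fin 3 → Fin K, ∑ k' : Fin 3 → Fin K,
        f (dist (u i - u j) (latVec P (coords K k' - coords K k))) := by
    simp only [Fintype.sum_prod_type, dist_add_latVec_add, Finset.mul_sum]
    refine Finset.sum_congr rfl fun i _ => ?_
    rw [Finset.sum_comm]
  exact h.trans_eq heq

/-- Weighted double sums depend Lipschitz-continuously on the kernel matrix:
`|Σ wᵢwⱼTᵢⱼ − c Σ wᵢwⱼSᵢⱼ| ≤ (Σ|wᵢwⱼ|) δ` if `|Tᵢⱼ − cSᵢⱼ| ≤ δ`. [folklore] -/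
theorem abs_gram_sub_le {n : ℕ} (w : Fin n → ℝ) (T S : Fin n → Fin n → ℝ) (c δ : ℝ)
    (h : ∀ i j, |T i j - c * S i j| ≤ δ) :
    |∑ i, ∑ j, w i * w j * T i j - c * ∑ i, ∑ j, w i * w j * S i j| ≤
      (∑ i, ∑ j, |w i * w j|) * δ := by
  have hrepr : ∑ i, ∑ j, w i * w j * T i j - c * ∑ i, ∑ j, w i * w j * S i j =
      ∑ i, ∑ j, w i * w j * (T i j - c * S i j) := by
    rw [Finset.mul_sum, ← Finset.sum_sub_distrib]
    refine Finset.sum_congr rfl fun i _ => ?_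
    rw [Finset.mul_sum, ← Finset.sum_sub_distrib]
    refine Finset.sum_congr rfl fun j _ => ?_
    ring
  rw [hrepr, Finset.sum_mul]
  refine (Finset.abs_sum_le_sum_abs _ _).trans (Finset.sum_le_sum fun i _ => ?_)
  rw [Finset.sum_mul]
  refine (Finset.abs_sum_le_sum_abs _ _).trans (Finset.sum_le_sum fun j _ => ?_)
  rw [abs_mul (w i * w j) (T i j - c * S i j)]
  exact mul_le_mul_of_nonneg_left (h i j) (abs_nonneg _)

/-- **The periodisation of a positive-type radial kernel is of positive type**: if all finite
Gram sums `Σ wᵢwⱼ f(|yᵢ − yⱼ|)` are `≥ 0` and the coset families of `f` along the periods of `P`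
are summable, then `Σᵢⱼ wᵢwⱼ Σ_d f(|uᵢ − uⱼ − latVec P d|) ≥ 0`. [folklore] -/
theorem periodisation_posType (P : PeriodicConfiguration 3) (f : ℝ → ℝ)
    (hpd : ∀ (n : ℕ) (y : Fin n → E3) (w : Fin n → ℝ),
      0 ≤ ∑ i, ∑ j, w i * w j * f (dist (y i) (y j)))
    (hs : ∀ v : E3, Summable fun d : Fin 3 → ℤ => f (dist v (latVec P d)))
    (n : ℕ) (u : Fin n → E3) (w : Fin n → ℝ) :
    0 ≤ ∑ i, ∑ j, w i * w j * ∑' d : Fin 3 → ℤ, f (dist (u i - u j) (latVec P d)) := by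
  set s : ℝ := ∑ i, ∑ j, w i * w j * ∑' d : Fin 3 → ℤ, f (dist (u i - u j) (latVec P d))
  set M : ℝ := ∑ i, ∑ j, |w i * w j|
  have hMnn : 0 ≤ M := Finset.sum_nonneg fun i _ => Finset.sum_nonneg fun j _ => abs_nonneg _
  have hM1 : 0 < M + 1 := by linarith
  refine le_of_forall_pos_le_add fun ε hε => ?_
  set ε' : ℝ := ε / (M + 1) with hε'
  have hε'pos : 0 < ε' := div_pos hε hM1
  -- a common `K ≥ 1` for the finitely many offsets `u i - u j`
  choose K₀ hK₀ using fun i j : Fin n => blockAverage P f (u i - u j) (hs (u i - u j)) hε'pos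
  obtain ⟨K, hK1, hKge⟩ : ∃ K : ℕ, 1 ≤ K ∧ ∀ i j, K₀ i j ≤ K := by
    refine ⟨Finset.univ.sup (fun p : Fin n × Fin n => K₀ p.1 p.2) + 1, Nat.succ_pos _,
      fun i j => Nat.le_succ_of_le ?_⟩
    exact Finset.le_sup (f := fun p : Fin n × Fin n => K₀ p.1 p.2) (Finset.mem_univ (i, j))
  have hK3 : (0 : ℝ) < (K : ℝ) ^ 3 := by
    have : (0 : ℝ) < K := by exact_mod_cast hK1
    positivity
  -- the block Gram sum is `≥ 0` and within `M ε' K³` of `K³ s`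
  have hG := gram_block_nonneg P f hpd n u w K
  have hdiff : |(∑ i, ∑ j, w i * w j * ∑ k : Fin 3 → Fin K, ∑ k' : Fin 3 → Fin K,
      f (dist (u i - u j) (latVec P (coords K k' - coords K k)))) - (K : ℝ) ^ 3 * s| ≤
      M * (ε' * (K : ℝ) ^ 3) :=
    abs_gram_sub_le w (fun i j => ∑ k : Fin 3 → Fin K, ∑ k' : Fin 3 → Fin K,
        f (dist (u i - u j) (latVec P (coords K k' - coords K k))))
      (fun i j => ∑' d : Fin 3 → ℤ, f (dist (u i - u j) (latVec P d))) ((K : ℝ) ^ 3)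
      (ε' * (K : ℝ) ^ 3) (fun i j => hK₀ i j K (hKge i j))
  have h1 := (abs_le.1 hdiff).2
  have h2 : 0 ≤ (K : ℝ) ^ 3 * (s + M * ε') := by linarith
  have h3 : 0 ≤ s + M * ε' := by
    by_contra hneg
    push Not at hneg
    have := mul_neg_of_pos_of_neg hK3 hneg
    linarith
  have h4 : M * ε' ≤ ε := by
    rw [hε', mul_div_assoc', div_le_iff₀ hM1]
    nlinarith
  linarith

/-- **Registered stub `stub_periodisationPosType` of crux item stmt-AtomisticToContinuum-11959**
(line `closure-makes-nogap-exact`, necessity side; signature verbatim) = `periodisation_posType`.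
[folklore] -/
theorem stub_periodisationPosType : ∀ (P : PeriodicConfiguration 3) (f : ℝ → ℝ),
    (∀ (n : ℕ) (y : Fin n → EuclideanSpace ℝ (Fin 3)) (w : Fin n → ℝ),
      0 ≤ ∑ i, ∑ j, w i * w j * f (dist (y i) (y j))) →
    (∀ v : EuclideanSpace ℝ (Fin 3), Summable fun d : Fin 3 → ℤ => f (dist v
      (Summit.AtomisticToContinuum.Crystallization.Theorems.ChargedEnergyGapNegative.Blocks.latVec P d))) →
    ∀ (n : ℕ) (u : Fin n → EuclideanSpace ℝ (Fin 3)) (w : Fin n → ℝ),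
      0 ≤ ∑ i, ∑ j, w i * w j * ∑' d : Fin 3 → ℤ, f (dist (u i - u j)
        (Summit.AtomisticToContinuum.Crystallization.Theorems.ChargedEnergyGapNegative.Blocks.latVec P d)) :=
  fun P f hpd hs n u w => periodisation_posType P f hpd hs n u w

end Summit.AtomisticToContinuum.Crystallization.Theorems.ThreeConeCertificateExactCertificate.Field

end
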